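import Literature.MathematicalPhysics.QuantumLattice.GrassmannSourceGrading
import Literature.MathematicalPhysics.QuantumLattice.GrassmannEffectiveActionLipschitzDB
import HarnessLib

/-!
# The SOURCE-GRADED single-scale step: kernels of `effAction C (A + B)` with `s ≥ 1` source legs are of size
# `‖B‖_h · T^{s-1}` under the smallness of the SOURCE-FREE part `A` ALONE (BGM 2006, §2.9 (4.6)–(4.8))

Topic `MathematicalPhysics/QuantumLattice`; continuation of `GrassmannSourceGrading` (the source filtration `srcGE P k`, `srcCount`,
stable under the step of a covariance vanishing on the sources) and `GrassmannEffectiveActionLipschitzDB` (the flat Lipschitz bound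
`Σ_{W : W_i = w} ‖kernel_m (effAction C (V₁+V₂) − effAction C V₁)(W)‖ ≤ ρ^{-m} e‖V₂‖_h/(1−θ)²`, `θ = eα(‖V₁‖_h+‖V₂‖_h)/κ²`).
In the external-field sector of Benfatto–Giuliani–Mastropietro 2006, §2.9, the kernels `ℬ^{(h)}` with one or two source legs `φ` are
bounded «proceeding as in §2.3» ((4.6)–(4.8)): the bound is LINEAR in the one-source kernels for one source leg, and for two source legs
it is linear in the two-source kernels plus QUADRATIC in the one-source kernels — and the convergence condition involves ONLY the
source-free part `𝒱^{(h)}` (the sources are never contracted, so the source kernels may be as large as they like).  This file derives exactly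
that from the flat Lipschitz bound by the DEAD-VARIABLE RESCALING of the sources (`GrassmannLinearSubstitution.effAction_map_mulLeft_of_covariance`:
`effAction C (S_c V) = S_c (effAction C V)` for a weight `c` with `c ⊗ c · C = C`, here `c = t` on the sources and `1` elsewhere): rescaling the
sources by `t = T⁻¹`, `T = 1 + 2eα‖B‖_h/((1−θ_A)κ²)`, makes the source part small enough for the flat bound at smallness `(1+θ_A)/2`, and a kernel
with `s` source legs scales back by `T^s`:

* `kernel_map_mulLeft_srcWeight` (`kernel (S_c F) m X = t^{srcCount X} · kernel F m X`),
  `map_mulLeft_srcWeight_eq_self_of_srcFree`, `map_mulLeft_srcWeight_map_mulLeft_srcWeight`, `effAction_map_mulLeft_srcWeight`,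
  `effPartitionFn_map_mulLeft_srcWeight`, **`kernel_effAction_eq_zero_of_srcFree`** (the step of a source-free interaction is source-free),
  `kernel_effAction_add_eq_of_srcCount_eq_zero` (the source-free kernels of `effAction C (A + B)` ARE those of `effAction C A`: the in-band
  flow is untouched by the sources), `map_map_mulLeft_srcWeight_comm` (substitutions preserving the source predicate commute with the rescaling),
  `norm_kernel_map_mulLeft_srcWeight_le`, `sum_norm_kernel_map_mulLeft_srcWeight_mul_le` (the profile of `S_c F` splits: source-free part + `t`·source part),
  **`sum_filter_norm_kernel_sub_mul_le_of_srcWeight`** (graded read-out: a pinned bound `B` on `S_c X − S_c Y` gives `t^{-s}B` on the `s`-source-leg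
  families of `X − Y` — how the two-volume STEP of the augmented flow is run on rescaled inputs and read back degree by degree);
* **`sum_norm_kernel_effAction_srcGraded_le_of_gramBounded`** — for `C` determinant-bounded (`IsGramBoundedR C κ`, rows/columns `≤ α`) and
  VANISHING ON THE SOURCES, `A` even source-free without constant part with pinned profile `N_A` and `θ_A := eα‖A‖_h/κ² < 1`, `B ∈ srcGE P 1`
  even without constant part with pinned profile `N_B` of ANY size: `Z(A+B)` is a unit and for every `s ≥ 1`, every degree `m ≥ 1` and pin,
  `Σ_{W : W_i = w, srcCount W = s} ‖kernel_m (effAction C (A+B)) (W)‖ ≤ 4ρ^{-m}·e‖B‖_h·T^{s−1}/(1−θ_A)²`, `T = 1 + 2eα‖B‖_h/((1−θ_A)κ²)`;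
* `sum_norm_kernel_effAction_srcGraded_le_two_of_gramBounded` — the `s ∈ {1,2}` total (what the source-degree-`≤ 2` truncated flow of
  `GrassmannSourceGrading.srcTrunc_effAction_srcTrunc` propagates): `≤ 4ρ^{-m}e‖B‖_h(1+T)/(1−θ_A)²`.

Everything is proved; no definition, no named fact.  RELATION TO THE TREE (referee ref-2, near-dup watch (R59bb)): the two-volume chain's instance of
record is `Summit.HubbardSuperconductivity.HubbardSuperconductivity.Theorems.TwoVolumeDefect.sum_norm_kernel_effAction_lowSource_le`
(`Summits/…/Theorems/KLProgrammeKLRegimeTwoVolumeSourceGradedStep`, labels `Γ × Fin 2`, spectator covariance, a FREE rescaling parameter `c`, source band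
`1 ≤ #src ≤ d`); the present file is its generic-predicate twin (any `Γ`, any source predicate `P`, covariance vanishing on the sources) with the rescaling
optimised (`t = T⁻¹`, exact-count grading, constants from `θ_A` alone) plus the consumer-side toolkit (`map_map_mulLeft_srcWeight_comm`,
`sum_filter_norm_kernel_sub_mul_le_of_srcWeight`, `sum_norm_kernel_map_mulLeft_srcWeight_mul_le`, `kernel_effAction_eq_zero_of_srcFree`,
`kernel_effAction_add_eq_of_srcCount_eq_zero`) that the instance file does not carry.

## Sources
G. Benfatto, A. Giuliani, V. Mastropietro, Ann. Henri Poincaré 7 (2006) 809–898, §2.9 (4.6)–(4.8), (2.86)–(2.90)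
[`BenfattoGiulianiMastropietro2006`]; K. Gawȩdzki, A. Kupiainen, Comm. Math. Phys. 102 (1985) 1–30, §3 [`GawedzkiKupiainen1985GrossNeveu`];
M. Salmhofer, *Renormalization: An Introduction* (Springer 1999), App. B.2 (B.23)–(B.25) (linear substitutions) [`Salmhofer1999`].
-/

noncomputable section

namespace Literature.MathematicalPhysics.QuantumLattice

open GrassmannAlgebra Finset

universe u

/-! ### §1 Rescaling the sources (any commutative `ℚ`-algebra) -/

section Rescale

variable (R : Type*) [CommRing R] [Algebra ℚ R] {Γ : Type*} [Fintype Γ] [DecidableEq Γ] (P : Γ → Prop) [DecidablePred P]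

omit [Algebra ℚ R] [Fintype Γ] [DecidableEq Γ] in
/-- The tensor power of the source weight `c = (t on sources, 1 elsewhere)` on a label family is `t^{srcCount}`. [folklore] -/
private theorem prod_srcWeight_eq_pow {m : ℕ} (t : R) (X : Fin m → Γ) :
    (∏ i, (if P (X i) then t else 1)) = t ^ srcCount P X := by
  rw [srcCount, prod_ite, prod_const_one, mul_one, prod_const]

omit [Fintype Γ] [DecidableEq Γ] in
/-- **Kernels of the source-rescaled element**: `kernel (S_c F) m X = t^{srcCount X} · kernel F m X`.
[cite: BenfattoGiulianiMastropietro2006, §2.9 (4.6)-(4.8)] -/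
theorem kernel_map_mulLeft_srcWeight (t : R) (F : GrassmannAlgebra R Γ) (m : ℕ) (X : Fin m → Γ) :
    kernel R (ExteriorAlgebra.map (LinearMap.mulLeft R (fun Y => if P Y then t else 1)) F) m X = t ^ srcCount P X * kernel R F m X := by
  rw [kernel_map_mulLeft, ← prod_srcWeight_eq_pow R P t X]

/-- An element is determined by its kernels. [folklore] -/
private theorem eq_of_kernel_eq' {F G : GrassmannAlgebra R Γ} (h : ∀ (m : ℕ) (X : Fin m → Γ), kernel R F m X = kernel R G m X) : F = G := by
  rw [eq_sum_presented_kernel R F, eq_sum_presented_kernel R G]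
  exact sum_congr rfl fun m _ => by rw [show kernel R F m = kernel R G m from funext (h m)]

/-- **A source-free element is fixed by every source rescaling.** [cite: BenfattoGiulianiMastropietro2006, §2.9 (4.6)-(4.8)] -/
theorem map_mulLeft_srcWeight_eq_self_of_srcFree (t : R) {F : GrassmannAlgebra R Γ}
    (hF : ∀ (m : ℕ) (X : Fin m → Γ), 0 < srcCount P X → kernel R F m X = 0) :
    ExteriorAlgebra.map (LinearMap.mulLeft R (fun Y => if P Y then t else 1)) F = F :=
  eq_of_kernel_eq' R fun m X => by
    rw [kernel_map_mulLeft_srcWeight]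
    rcases Nat.eq_zero_or_pos (srcCount P X) with h0 | hpos
    · rw [h0, pow_zero, one_mul]
    · rw [hF m X hpos, mul_zero]

/-- Two source rescalings with `t · t' = 1` compose to the identity. [cite: BenfattoGiulianiMastropietro2006, §2.9 (4.6)-(4.8)] -/
theorem map_mulLeft_srcWeight_map_mulLeft_srcWeight {t t' : R} (h : t * t' = 1) (F : GrassmannAlgebra R Γ) :
    ExteriorAlgebra.map (LinearMap.mulLeft R (fun Y => if P Y then t else 1))
      (ExteriorAlgebra.map (LinearMap.mulLeft R (fun Y => if P Y then t' else 1)) F) = F :=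
  eq_of_kernel_eq' R fun m X => by
    rw [kernel_map_mulLeft_srcWeight, kernel_map_mulLeft_srcWeight, ← mul_assoc, ← mul_pow, h, one_pow, one_mul]

omit [Fintype Γ] [DecidableEq Γ] [Algebra ℚ R] in
/-- A covariance vanishing on the sources is invariant under the source weight: `c(X) c(Y) C(X,Y) = C(X,Y)`. [folklore] -/
private theorem srcWeight_mul_srcWeight_mul_eq (t : R) (C : Matrix Γ Γ R) (hC : ∀ X Y, P X ∨ P Y → C X Y = 0) (X Y : Γ) :
    (if P X then t else 1) * (if P Y then t else 1) * C X Y = C X Y := by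
  by_cases hX : P X
  · rw [hC X Y (Or.inl hX), mul_zero]
  · by_cases hY : P Y
    · rw [hC X Y (Or.inr hY), mul_zero]
    · rw [if_neg hX, if_neg hY, one_mul, one_mul]

/-- **The step commutes with a source rescaling** (dead variables: `effAction C (S_c V) = S_c (effAction C V)` for a covariance vanishing on
the sources). [cite: BenfattoGiulianiMastropietro2006, §2.9 (4.6)-(4.8)] -/
theorem effAction_map_mulLeft_srcWeight (t : R) (C : Matrix Γ Γ R) (hC : ∀ X Y, P X ∨ P Y → C X Y = 0) (V : GrassmannAlgebra R Γ) :
    effAction R C (ExteriorAlgebra.map (LinearMap.mulLeft R (fun Y => if P Y then t else 1)) V) =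
      ExteriorAlgebra.map (LinearMap.mulLeft R (fun Y => if P Y then t else 1)) (effAction R C V) :=
  effAction_map_mulLeft_of_covariance R _ (fun X Y => srcWeight_mul_srcWeight_mul_eq R P t C hC X Y) V

/-- The partition function is invariant under a source rescaling. [cite: BenfattoGiulianiMastropietro2006, §2.9 (4.6)-(4.8)] -/
theorem effPartitionFn_map_mulLeft_srcWeight (t : R) (C : Matrix Γ Γ R) (hC : ∀ X Y, P X ∨ P Y → C X Y = 0) (V : GrassmannAlgebra R Γ) :
    effPartitionFn R C (ExteriorAlgebra.map (LinearMap.mulLeft R (fun Y => if P Y then t else 1)) V) = effPartitionFn R C V := by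
  rw [effPartitionFn_map, toMatrix'_mulLeft, diagonal_transpose_mul_mul_diagonal]
  congr 1
  exact Matrix.ext fun X Y => srcWeight_mul_srcWeight_mul_eq R P t C hC X Y

/-- **The step of a SOURCE-FREE interaction is source-free**: every kernel of `effAction C A` with a source leg vanishes (the source weight
`t = 0` fixes `A`, hence `effAction C A`). [cite: BenfattoGiulianiMastropietro2006, §2.9 (4.6)-(4.8)] -/
theorem kernel_effAction_eq_zero_of_srcFree (C : Matrix Γ Γ R) (hC : ∀ X Y, P X ∨ P Y → C X Y = 0) {A : GrassmannAlgebra R Γ}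
    (hA : ∀ (m : ℕ) (X : Fin m → Γ), 0 < srcCount P X → kernel R A m X = 0) {m : ℕ} {X : Fin m → Γ} (hX : 0 < srcCount P X) :
    kernel R (effAction R C A) m X = 0 := by
  have h := effAction_map_mulLeft_srcWeight R P (0 : R) C hC A
  rw [map_mulLeft_srcWeight_eq_self_of_srcFree R P 0 hA] at h
  rw [h, kernel_map_mulLeft_srcWeight, zero_pow hX.ne', zero_mul]

/-- **The source-free kernels of `effAction C (A + B)` are those of `effAction C A`** when `B` is purely source (`B ∈ srcGE P 1`): the sources
do not feed back into the in-band flow. [cite: BenfattoGiulianiMastropietro2006, §2.9 (4.6)-(4.8)] -/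
theorem kernel_effAction_add_eq_of_srcCount_eq_zero (C : Matrix Γ Γ R) (hC : ∀ X Y, P X ∨ P Y → C X Y = 0) {A B : GrassmannAlgebra R Γ}
    (hA0 : constPart R A = 0) (hB0 : constPart R B = 0) (hB : B ∈ srcGE R P 1) {m : ℕ} {X : Fin m → Γ} (hX : srcCount P X = 0) :
    kernel R (effAction R C (A + B)) m X = kernel R (effAction R C A) m X :=
  kernel_eq_kernel_of_sub_mem_srcGE R P (effAction_sub_effAction_mem_srcGE R P C hC (by rw [map_add, hA0, hB0, add_zero]) hA0
    (by rw [add_sub_cancel_left]; exact hB)) (by rw [hX]; exact Nat.one_pos)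

omit [Algebra ℚ R] in
/-- **Substitutions preserving the source predicate commute with the source rescaling** (block embeddings, re-sectorisations of the alive legs
`⊕ 1`, …): `map f (S_c F) = S_{c'} (map f F)` whenever `M(X', X) ≠ 0 ⟹ (P X ↔ P' X')`. [cite: Salmhofer1999, App. B.2 (B.23)-(B.25)] -/
theorem map_map_mulLeft_srcWeight_comm {Γ' : Type*} [Fintype Γ'] [DecidableEq Γ'] (P' : Γ' → Prop) [DecidablePred P']
    (f : (Γ → R) →ₗ[R] (Γ' → R)) (hf : ∀ (X : Γ) (X' : Γ'), LinearMap.toMatrix' f X' X ≠ 0 → (P X ↔ P' X')) (t : R)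
    (F : GrassmannAlgebra R Γ) :
    ExteriorAlgebra.map f (ExteriorAlgebra.map (LinearMap.mulLeft R (fun Y => if P Y then t else 1)) F) =
      ExteriorAlgebra.map (LinearMap.mulLeft R (fun Y' => if P' Y' then t else 1)) (ExteriorAlgebra.map f F) := by
  have hlin : f ∘ₗ LinearMap.mulLeft R (fun Y => if P Y then t else 1) =
      LinearMap.mulLeft R (fun Y' => if P' Y' then t else 1) ∘ₗ f := by
    refine LinearMap.ext fun v => funext fun X' => ?_
    simp only [LinearMap.comp_apply, LinearMap.mulLeft_apply, Pi.mul_apply]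
    rw [apply_eq_sum_toMatrix' (f := f), apply_eq_sum_toMatrix' (f := f), mul_sum]
    refine sum_congr rfl fun X _ => ?_
    simp only [Pi.mul_apply]
    by_cases hM : LinearMap.toMatrix' f X' X = 0
    · rw [hM, zero_mul, zero_mul, mul_zero]
    · have hiff := hf X X' hM
      by_cases hX : P X
      · rw [if_pos hX, if_pos (hiff.1 hX)]; ring
      · rw [if_neg hX, if_neg (fun h => hX (hiff.2 h))]; ring
  rw [map_map_eq_map_comp, map_map_eq_map_comp, hlin]

end Rescale

/-! ### §2 The source-graded step bound -/

section Step

variable {𝕜 : Type*} [RCLike 𝕜] {Γ : Type u} [Fintype Γ] [DecidableEq Γ] (P : Γ → Prop) [DecidablePred P]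

omit [Fintype Γ] in
/-- The kernels of the source-rescaled purely-source element: `‖kernel (S_c B) m X‖ ≤ t · ‖kernel B m X‖` for `0 ≤ t ≤ 1`, `B ∈ srcGE P 1`.
[cite: BenfattoGiulianiMastropietro2006, §2.9 (4.6)-(4.8)] -/
theorem norm_kernel_map_mulLeft_srcWeight_le {t : ℝ} (ht0 : 0 ≤ t) (ht1 : t ≤ 1) {B : GrassmannAlgebra 𝕜 Γ} (hB : B ∈ srcGE 𝕜 P 1)
    (m : ℕ) (X : Fin m → Γ) :
    ‖kernel 𝕜 (ExteriorAlgebra.map (LinearMap.mulLeft 𝕜 (fun Y => if P Y then ((t : ℝ) : 𝕜) else 1)) B) m X‖ ≤ t * ‖kernel 𝕜 B m X‖ := by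
  rw [kernel_map_mulLeft_srcWeight, norm_mul, norm_pow, RCLike.norm_ofReal, abs_of_nonneg ht0]
  rcases Nat.eq_zero_or_pos (srcCount P X) with h0 | hpos
  · rw [kernel_eq_zero_of_mem_srcGE 𝕜 P hB (by rw [h0]; exact Nat.one_pos), norm_zero, mul_zero, mul_zero]
  · exact mul_le_mul_of_nonneg_right (pow_le_of_le_one ht0 ht1 hpos.ne') (norm_nonneg _)

omit [DecidableEq Γ] in
/-- `normV` is homogeneous in the profile. [folklore] -/
private theorem normV_const_mul' (κ ρ t : ℝ) (N : ℕ → ℝ) : normV Γ κ ρ (fun m' => t * N m') = t * normV Γ κ ρ N := by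
  rw [normV, normV, mul_sum]
  exact sum_congr rfl fun _ _ => by ring

omit [Fintype Γ] [DecidableEq Γ] in
/-- **Graded read-out of a rescaled pinned bound**: a bound on the (weighted) kernels of `S_c X − S_c Y` over a set of label families gives, on the
families with exactly `s` source legs, the bound `t^{-s} · B` for `X − Y` (the two-volume / two-cutoff defects of the augmented flow are compared AFTER
rescaling the sources, then read back degree by degree). [cite: BenfattoGiulianiMastropietro2006, §2.9 (4.6)-(4.8)] -/
theorem sum_filter_norm_kernel_sub_mul_le_of_srcWeight {t : ℝ} (ht : 0 < t) (X Y : GrassmannAlgebra 𝕜 Γ) {m : ℕ} (S : Finset (Fin m → Γ))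
    (wt : (Fin m → Γ) → ℝ) (hwt : ∀ W, 0 ≤ wt W) {B : ℝ}
    (h : ∑ W ∈ S, ‖kernel 𝕜 (ExteriorAlgebra.map (LinearMap.mulLeft 𝕜 (fun Y => if P Y then ((t : ℝ) : 𝕜) else 1)) X -
        ExteriorAlgebra.map (LinearMap.mulLeft 𝕜 (fun Y => if P Y then ((t : ℝ) : 𝕜) else 1)) Y) m W‖ * wt W ≤ B) (s : ℕ) :
    ∑ W ∈ S.filter (fun W => srcCount P W = s), ‖kernel 𝕜 (X - Y) m W‖ * wt W ≤ t⁻¹ ^ s * B := by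
  have hpt : ∀ W ∈ S.filter (fun W => srcCount P W = s), ‖kernel 𝕜 (X - Y) m W‖ * wt W =
      t⁻¹ ^ s * (‖kernel 𝕜 (ExteriorAlgebra.map (LinearMap.mulLeft 𝕜 (fun Y => if P Y then ((t : ℝ) : 𝕜) else 1)) X -
        ExteriorAlgebra.map (LinearMap.mulLeft 𝕜 (fun Y => if P Y then ((t : ℝ) : 𝕜) else 1)) Y) m W‖ * wt W) := by
    intro W hW
    have hs : srcCount P W = s := (mem_filter.1 hW).2
    rw [← map_sub, kernel_map_mulLeft_srcWeight, hs, norm_mul, norm_pow, RCLike.norm_ofReal, abs_of_pos ht, ← mul_assoc, ← mul_assoc,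
      ← mul_pow, inv_mul_cancel₀ ht.ne', one_pow, one_mul]
  calc ∑ W ∈ S.filter (fun W => srcCount P W = s), ‖kernel 𝕜 (X - Y) m W‖ * wt W
      = t⁻¹ ^ s * ∑ W ∈ S.filter (fun W => srcCount P W = s),
          ‖kernel 𝕜 (ExteriorAlgebra.map (LinearMap.mulLeft 𝕜 (fun Y => if P Y then ((t : ℝ) : 𝕜) else 1)) X -
            ExteriorAlgebra.map (LinearMap.mulLeft 𝕜 (fun Y => if P Y then ((t : ℝ) : 𝕜) else 1)) Y) m W‖ * wt W := by
        rw [mul_sum]; exact sum_congr rfl hpt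
    _ ≤ t⁻¹ ^ s * B := mul_le_mul_of_nonneg_left ((sum_le_sum_of_subset_of_nonneg (filter_subset _ S)
        fun W _ _ => mul_nonneg (norm_nonneg _) (hwt W)).trans h) (by positivity)

omit [Fintype Γ] [DecidableEq Γ] in
/-- **The profile of a source-rescaled element splits**: `Σ_S ‖kernel (S_c F)‖·wt ≤ Σ_{S, no source leg} ‖kernel F‖·wt + t·Σ_{S, ≥ 1 source leg} ‖kernel F‖·wt`
for `0 ≤ t ≤ 1` — the source sector is made as small as one likes, the source-free sector is untouched. [cite: BenfattoGiulianiMastropietro2006, §2.9 (4.6)-(4.8)] -/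
theorem sum_norm_kernel_map_mulLeft_srcWeight_mul_le {t : ℝ} (ht0 : 0 ≤ t) (ht1 : t ≤ 1) (F : GrassmannAlgebra 𝕜 Γ) {m : ℕ}
    (S : Finset (Fin m → Γ)) (wt : (Fin m → Γ) → ℝ) (hwt : ∀ W, 0 ≤ wt W) :
    ∑ W ∈ S, ‖kernel 𝕜 (ExteriorAlgebra.map (LinearMap.mulLeft 𝕜 (fun Y => if P Y then ((t : ℝ) : 𝕜) else 1)) F) m W‖ * wt W ≤
      ∑ W ∈ S.filter (fun W => srcCount P W = 0), ‖kernel 𝕜 F m W‖ * wt W +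
        t * ∑ W ∈ S.filter (fun W => 0 < srcCount P W), ‖kernel 𝕜 F m W‖ * wt W := by
  rw [← sum_filter_add_sum_filter_not S (fun W => srcCount P W = 0)]
  refine add_le_add (le_of_eq (sum_congr rfl fun W hW => ?_)) ?_
  · rw [kernel_map_mulLeft_srcWeight, (mem_filter.1 hW).2, pow_zero, one_mul]
  · rw [show S.filter (fun W => ¬ srcCount P W = 0) = S.filter (fun W => 0 < srcCount P W) from
        filter_congr fun W _ => Nat.pos_iff_ne_zero.symm, mul_sum]
    refine sum_le_sum fun W hW => ?_
    have hs : 0 < srcCount P W := (mem_filter.1 hW).2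
    rw [kernel_map_mulLeft_srcWeight, norm_mul, norm_pow, RCLike.norm_ofReal, abs_of_nonneg ht0, mul_assoc]
    exact mul_le_mul_of_nonneg_right (pow_le_of_le_one ht0 ht1 hs.ne') (mul_nonneg (norm_nonneg _) (hwt W))

variable (C : Matrix Γ Γ 𝕜)

/-- **The source-graded single-scale step.**  `C` determinant-bounded with constant `κ`, rows/columns `≤ α`, VANISHING ON THE SOURCES; `A` even,
source-free, without constant part, pinned profile `N_A`, `θ_A = eα‖A‖_h/κ² < 1`; `B ∈ srcGE P 1` even without constant part with pinned profile
`N_B` of ANY size.  Then `Z(A + B)` is a unit and, for every `s ≥ 1`, degree `m ≥ 1` and pin `(i, w)`,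
`Σ_{W : W_i = w, srcCount W = s} ‖kernel_m (effAction C (A + B)) (W)‖ ≤ 4·ρ^{-m}·e‖B‖_h·T^{s−1}/(1 − θ_A)²`, `T = 1 + 2eα‖B‖_h/((1−θ_A)κ²)`
— linear in the source part for one source leg, at most quadratic for two (BGM 2006, §2.9: the bounds for `ℬ^{(h)}` «proceeding as in §2.3»,
the sources never being contracted). [cite: BenfattoGiulianiMastropietro2006, §2.9 (4.6)-(4.8)] -/
theorem sum_norm_kernel_effAction_srcGraded_le_of_gramBounded {κ : ℝ} (hκ : 0 < κ) (hGB : IsGramBoundedR C κ)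
    (hC : ∀ X Y, P X ∨ P Y → C X Y = 0)
    (A B : GrassmannAlgebra 𝕜 Γ) (hAe : A ∈ evenPart 𝕜 Γ) (hBe : B ∈ evenPart 𝕜 Γ) (hA0 : constPart 𝕜 A = 0) (hB0 : constPart 𝕜 B = 0)
    (hAsrc : ∀ (m : ℕ) (X : Fin m → Γ), 0 < srcCount P X → kernel 𝕜 A m X = 0) (hBsrc : B ∈ srcGE 𝕜 P 1)
    (NA NB : ℕ → ℝ) (hNA0 : ∀ m', 0 ≤ NA m') (hNB0 : ∀ m', 0 ≤ NB m')
    (hNA : ∀ m' (j : Fin (2 * m')) (w : Γ), ∑ Y ∈ univ.filter (fun Y : Fin (2 * m') → Γ => Y j = w), ‖kernel 𝕜 A (2 * m') Y‖ ≤ NA m')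
    (hNB : ∀ m' (j : Fin (2 * m')) (w : Γ), ∑ Y ∈ univ.filter (fun Y : Fin (2 * m') → Γ => Y j = w), ‖kernel 𝕜 B (2 * m') Y‖ ≤ NB m')
    {α : ℝ} (hα : 0 < α) (hrow : ∀ X, ∑ Y, ‖C X Y‖ ≤ α) (hcol : ∀ Y, ∑ X, ‖C X Y‖ ≤ α) {ρ : ℝ} (hρ : 0 < ρ)
    (hθ : Real.exp 1 * α * normV Γ κ ρ NA / κ ^ 2 < 1) :
    IsUnit (effPartitionFn 𝕜 C (A + B)) ∧ ∀ {m : ℕ}, 0 < m → ∀ (i : Fin m) (w : Γ) (s : ℕ), 1 ≤ s →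
      ∑ W ∈ univ.filter (fun W : Fin m → Γ => W i = w ∧ srcCount P W = s), ‖kernel 𝕜 (effAction 𝕜 C (A + B)) m W‖ ≤
        4 * ρ⁻¹ ^ m * (Real.exp 1 * normV Γ κ ρ NB) *
          (1 + 2 * Real.exp 1 * α * normV Γ κ ρ NB / ((1 - Real.exp 1 * α * normV Γ κ ρ NA / κ ^ 2) * κ ^ 2)) ^ (s - 1) /
          (1 - Real.exp 1 * α * normV Γ κ ρ NA / κ ^ 2) ^ 2 := by
  -- abbreviations
  have ha0 : 0 ≤ normV Γ κ ρ NA := normV_nonneg hκ.le hρ.le hNA0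
  have hb0 : 0 ≤ normV Γ κ ρ NB := normV_nonneg hκ.le hρ.le hNB0
  have h1θ : 0 < 1 - Real.exp 1 * α * normV Γ κ ρ NA / κ ^ 2 := sub_pos.2 hθ
  have hκ2 : 0 < κ ^ 2 := by positivity
  set θA : ℝ := Real.exp 1 * α * normV Γ κ ρ NA / κ ^ 2 with hθA
  set b : ℝ := normV Γ κ ρ NB with hb
  set T : ℝ := 1 + 2 * Real.exp 1 * α * b / ((1 - θA) * κ ^ 2) with hT
  have hT1 : 1 ≤ T := by rw [hT]; exact le_add_of_nonneg_right (by positivity)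
  have hT0 : 0 < T := one_pos.trans_le hT1
  set t : ℝ := T⁻¹ with ht
  have ht0 : 0 < t := inv_pos.2 hT0
  have ht1 : t ≤ 1 := inv_le_one_of_one_le₀ hT1
  have hTt : T * t = 1 := mul_inv_cancel₀ hT0.ne'
  -- the key smallness: `eα·(t b)/κ² ≤ (1 − θ_A)/2`
  have htb : Real.exp 1 * α * (t * b) / κ ^ 2 ≤ (1 - θA) / 2 := by
    have hTb : Real.exp 1 * α * b ≤ (1 - θA) / 2 * κ ^ 2 * T := by
      rw [hT, mul_add, mul_one, mul_div_assoc', div_eq_mul_inv ((1 - θA) / 2 * κ ^ 2 * (2 * Real.exp 1 * α * b)),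
        show (1 - θA) / 2 * κ ^ 2 * (2 * Real.exp 1 * α * b) * ((1 - θA) * κ ^ 2)⁻¹ = Real.exp 1 * α * b by
          field_simp]
      exact le_add_of_nonneg_left (by positivity)
    rw [div_le_iff₀ hκ2, show Real.exp 1 * α * (t * b) = Real.exp 1 * α * b * t by ring]
    calc Real.exp 1 * α * b * t ≤ (1 - θA) / 2 * κ ^ 2 * T * t := mul_le_mul_of_nonneg_right hTb ht0.le
      _ = (1 - θA) / 2 * κ ^ 2 := by rw [mul_assoc, hTt, mul_one]
  -- the rescaled source part
  set Bt : GrassmannAlgebra 𝕜 Γ := ExteriorAlgebra.map (LinearMap.mulLeft 𝕜 (fun Y => if P Y then ((t : ℝ) : 𝕜) else 1)) B with hBt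
  have hBte : Bt ∈ evenPart 𝕜 Γ := (mem_evenPart_iff).2 (map_mem_evenOdd_zero 𝕜 _ ((mem_evenPart_iff).1 hBe))
  have hBt0 : constPart 𝕜 Bt = 0 := by rw [hBt, constPart_map, hB0]
  have hNBt0 : ∀ m', 0 ≤ t * NB m' := fun m' => mul_nonneg ht0.le (hNB0 m')
  have hNBt : ∀ m' (j : Fin (2 * m')) (w : Γ), ∑ Y ∈ univ.filter (fun Y : Fin (2 * m') → Γ => Y j = w), ‖kernel 𝕜 Bt (2 * m') Y‖ ≤
      (fun m' => t * NB m') m' := by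
    intro m' j w
    calc ∑ Y ∈ univ.filter (fun Y : Fin (2 * m') → Γ => Y j = w), ‖kernel 𝕜 Bt (2 * m') Y‖
        ≤ ∑ Y ∈ univ.filter (fun Y : Fin (2 * m') → Γ => Y j = w), t * ‖kernel 𝕜 B (2 * m') Y‖ :=
          sum_le_sum fun Y _ => norm_kernel_map_mulLeft_srcWeight_le P ht0.le ht1 hBsrc _ Y
      _ ≤ t * NB m' := by rw [← mul_sum]; exact mul_le_mul_of_nonneg_left (hNB m' j w) ht0.le
  have hnormBt : normV Γ κ ρ (fun m' => t * NB m') = t * b := normV_const_mul' κ ρ t NB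
  -- the flat Lipschitz bound at the rescaled source part
  have hθ' : Real.exp 1 * α * (normV Γ κ ρ NA + normV Γ κ ρ (fun m' => t * NB m')) / κ ^ 2 < 1 := by
    rw [hnormBt, mul_add, add_div]
    change θA + Real.exp 1 * α * (t * b) / κ ^ 2 < 1
    linarith
  have h1θ' : (1 - θA) / 2 ≤ 1 - Real.exp 1 * α * (normV Γ κ ρ NA + normV Γ κ ρ (fun m' => t * NB m')) / κ ^ 2 := by
    rw [hnormBt, mul_add, add_div]
    change (1 - θA) / 2 ≤ 1 - (θA + Real.exp 1 * α * (t * b) / κ ^ 2)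
    linarith
  obtain ⟨_, hZABt, hLip⟩ := sum_norm_kernel_effAction_add_sub_le_of_gramBounded C hκ hGB A Bt hAe hBte hA0 hBt0 NA (fun m' => t * NB m')
    hNA0 hNBt0 hNA hNBt hα hrow hcol hρ hθ'
  -- `A + B` is the `T`-rescaling of `A + Bt`
  have hTt' : ((T : ℝ) : 𝕜) * ((t : ℝ) : 𝕜) = 1 := by rw [← RCLike.ofReal_mul, hTt, RCLike.ofReal_one]
  have hAB : A + B = ExteriorAlgebra.map (LinearMap.mulLeft 𝕜 (fun Y => if P Y then ((T : ℝ) : 𝕜) else 1)) (A + Bt) := by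
    rw [map_add, map_mulLeft_srcWeight_eq_self_of_srcFree 𝕜 P _ hAsrc, hBt, map_mulLeft_srcWeight_map_mulLeft_srcWeight 𝕜 P hTt' B]
  refine ⟨?_, ?_⟩
  · rw [hAB, effPartitionFn_map_mulLeft_srcWeight 𝕜 P _ C hC]
    exact hZABt
  · intro m hm i w s hs
    -- pointwise: `‖kernel (effAction C (A+B)) W‖ = T^s ‖kernel (effAction C (A+Bt)) W − kernel (effAction C A) W‖`
    have hpt : ∀ W ∈ univ.filter (fun W : Fin m → Γ => W i = w ∧ srcCount P W = s),
        ‖kernel 𝕜 (effAction 𝕜 C (A + B)) m W‖ =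
          T ^ s * ‖kernel 𝕜 (effAction 𝕜 C (A + Bt)) m W - kernel 𝕜 (effAction 𝕜 C A) m W‖ := by
      intro W hW
      have hWs : srcCount P W = s := ((mem_filter.1 hW).2).2
      rw [hAB, effAction_map_mulLeft_srcWeight 𝕜 P _ C hC, kernel_map_mulLeft_srcWeight, hWs,
        kernel_effAction_eq_zero_of_srcFree 𝕜 P C hC hAsrc (by rw [hWs]; exact hs), sub_zero, norm_mul, norm_pow,
        RCLike.norm_ofReal, abs_of_pos hT0]
    have hsub : univ.filter (fun W : Fin m → Γ => W i = w ∧ srcCount P W = s) ⊆ univ.filter (fun W : Fin m → Γ => W i = w) :=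
      fun W hW => mem_filter.2 ⟨mem_univ _, ((mem_filter.1 hW).2).1⟩
    have hden : ρ⁻¹ ^ m * (Real.exp 1 * normV Γ κ ρ (fun m' => t * NB m')) /
        (1 - Real.exp 1 * α * (normV Γ κ ρ NA + normV Γ κ ρ (fun m' => t * NB m')) / κ ^ 2) ^ 2 ≤
        ρ⁻¹ ^ m * (Real.exp 1 * (t * b)) / ((1 - θA) / 2) ^ 2 := by
      have h := pow_le_pow_left₀ (by positivity) h1θ' 2
      rw [hnormBt] at h ⊢
      exact div_le_div_of_nonneg_left (by positivity) (by positivity) h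
    have hTs : T ^ s * t = T ^ (s - 1) := by
      obtain ⟨k, rfl⟩ : ∃ k, s = k + 1 := ⟨s - 1, by omega⟩
      rw [pow_succ, Nat.add_sub_cancel, mul_assoc, hTt, mul_one]
    calc ∑ W ∈ univ.filter (fun W : Fin m → Γ => W i = w ∧ srcCount P W = s), ‖kernel 𝕜 (effAction 𝕜 C (A + B)) m W‖
        = ∑ W ∈ univ.filter (fun W : Fin m → Γ => W i = w ∧ srcCount P W = s),
            T ^ s * ‖kernel 𝕜 (effAction 𝕜 C (A + Bt)) m W - kernel 𝕜 (effAction 𝕜 C A) m W‖ := sum_congr rfl hpt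
      _ = T ^ s * ∑ W ∈ univ.filter (fun W : Fin m → Γ => W i = w ∧ srcCount P W = s),
            ‖kernel 𝕜 (effAction 𝕜 C (A + Bt)) m W - kernel 𝕜 (effAction 𝕜 C A) m W‖ := by rw [mul_sum]
      _ ≤ T ^ s * ∑ W ∈ univ.filter (fun W : Fin m → Γ => W i = w),
            ‖kernel 𝕜 (effAction 𝕜 C (A + Bt)) m W - kernel 𝕜 (effAction 𝕜 C A) m W‖ :=
          mul_le_mul_of_nonneg_left (sum_le_sum_of_subset_of_nonneg hsub fun _ _ _ => norm_nonneg _) (by positivity)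
      _ ≤ T ^ s * (ρ⁻¹ ^ m * (Real.exp 1 * normV Γ κ ρ (fun m' => t * NB m')) /
            (1 - Real.exp 1 * α * (normV Γ κ ρ NA + normV Γ κ ρ (fun m' => t * NB m')) / κ ^ 2) ^ 2) :=
          mul_le_mul_of_nonneg_left (hLip hm i w) (by positivity)
      _ ≤ T ^ s * (ρ⁻¹ ^ m * (Real.exp 1 * (t * b)) / ((1 - θA) / 2) ^ 2) := mul_le_mul_of_nonneg_left hden (by positivity)
      _ = 4 * ρ⁻¹ ^ m * (Real.exp 1 * b) * (T ^ s * t) / (1 - θA) ^ 2 := by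
          field_simp
          ring
      _ = 4 * ρ⁻¹ ^ m * (Real.exp 1 * b) * T ^ (s - 1) / (1 - θA) ^ 2 := by rw [hTs]

/-- **The source sector of source degree `≤ 2`** (one and two source legs together, the part the truncated flow
`GrassmannSourceGrading.srcTrunc_effAction_srcTrunc` propagates): `Σ_{W : W_i = w, 1 ≤ srcCount W ≤ 2} ‖kernel_m (effAction C (A+B))(W)‖ ≤
4ρ^{-m}e‖B‖_h(1 + T)/(1−θ_A)²`. [cite: BenfattoGiulianiMastropietro2006, §2.9 (4.6)-(4.8)] -/
theorem sum_norm_kernel_effAction_srcGraded_le_two_of_gramBounded {κ : ℝ} (hκ : 0 < κ) (hGB : IsGramBoundedR C κ)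
    (hC : ∀ X Y, P X ∨ P Y → C X Y = 0)
    (A B : GrassmannAlgebra 𝕜 Γ) (hAe : A ∈ evenPart 𝕜 Γ) (hBe : B ∈ evenPart 𝕜 Γ) (hA0 : constPart 𝕜 A = 0) (hB0 : constPart 𝕜 B = 0)
    (hAsrc : ∀ (m : ℕ) (X : Fin m → Γ), 0 < srcCount P X → kernel 𝕜 A m X = 0) (hBsrc : B ∈ srcGE 𝕜 P 1)
    (NA NB : ℕ → ℝ) (hNA0 : ∀ m', 0 ≤ NA m') (hNB0 : ∀ m', 0 ≤ NB m')
    (hNA : ∀ m' (j : Fin (2 * m')) (w : Γ), ∑ Y ∈ univ.filter (fun Y : Fin (2 * m') → Γ => Y j = w), ‖kernel 𝕜 A (2 * m') Y‖ ≤ NA m')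
    (hNB : ∀ m' (j : Fin (2 * m')) (w : Γ), ∑ Y ∈ univ.filter (fun Y : Fin (2 * m') → Γ => Y j = w), ‖kernel 𝕜 B (2 * m') Y‖ ≤ NB m')
    {α : ℝ} (hα : 0 < α) (hrow : ∀ X, ∑ Y, ‖C X Y‖ ≤ α) (hcol : ∀ Y, ∑ X, ‖C X Y‖ ≤ α) {ρ : ℝ} (hρ : 0 < ρ)
    (hθ : Real.exp 1 * α * normV Γ κ ρ NA / κ ^ 2 < 1) {m : ℕ} (hm : 0 < m) (i : Fin m) (w : Γ) :
    ∑ W ∈ univ.filter (fun W : Fin m → Γ => W i = w ∧ 1 ≤ srcCount P W ∧ srcCount P W ≤ 2), ‖kernel 𝕜 (effAction 𝕜 C (A + B)) m W‖ ≤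
      4 * ρ⁻¹ ^ m * (Real.exp 1 * normV Γ κ ρ NB) *
        (1 + (1 + 2 * Real.exp 1 * α * normV Γ κ ρ NB / ((1 - Real.exp 1 * α * normV Γ κ ρ NA / κ ^ 2) * κ ^ 2))) /
        (1 - Real.exp 1 * α * normV Γ κ ρ NA / κ ^ 2) ^ 2 := by
  obtain ⟨-, hstep⟩ := sum_norm_kernel_effAction_srcGraded_le_of_gramBounded P C hκ hGB hC A B hAe hBe hA0 hB0 hAsrc hBsrc NA NB hNA0 hNB0
    hNA hNB hα hrow hcol hρ hθ
  have h1 := hstep hm i w 1 le_rfl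
  have h2 := hstep hm i w 2 (by norm_num)
  rw [Nat.sub_self, pow_zero, mul_one] at h1
  rw [show 2 - 1 = 1 from rfl, pow_one] at h2
  -- split the filter into `srcCount = 1` and `srcCount = 2`
  have hsplit : univ.filter (fun W : Fin m → Γ => W i = w ∧ 1 ≤ srcCount P W ∧ srcCount P W ≤ 2) =
      univ.filter (fun W : Fin m → Γ => W i = w ∧ srcCount P W = 1) ∪ univ.filter (fun W : Fin m → Γ => W i = w ∧ srcCount P W = 2) := by
    ext W
    simp only [mem_filter, mem_univ, true_and, mem_union]
    constructor
    · rintro ⟨hw, h1', h2'⟩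
      rcases Nat.lt_or_ge (srcCount P W) 2 with hlt | hge
      · exact Or.inl ⟨hw, by omega⟩
      · exact Or.inr ⟨hw, by omega⟩
    · rintro (⟨hw, h⟩ | ⟨hw, h⟩) <;> exact ⟨hw, by omega, by omega⟩
  have hdisj : Disjoint (univ.filter (fun W : Fin m → Γ => W i = w ∧ srcCount P W = 1))
      (univ.filter (fun W : Fin m → Γ => W i = w ∧ srcCount P W = 2)) :=
    disjoint_filter.2 fun W _ h1' h2' => by omega
  rw [hsplit, sum_union hdisj]
  have h1θ : 0 < 1 - Real.exp 1 * α * normV Γ κ ρ NA / κ ^ 2 := sub_pos.2 hθ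
  calc _ ≤ _ := add_le_add h1 h2
    _ = _ := by
        field_simp

end Step

end Literature.MathematicalPhysics.QuantumLattice

end
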